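import Literature.NumberTheory.EllipticCurves.HeegnerPointsKolyvaginPrimaryUnramifiedProofs
import Literature.NumberTheory.EllipticCurves.CubicTwistTransportJZero
import Literature.NumberTheory.GaloisRepresentations.ContinuousCorestriction
import Literature.NumberTheory.GaloisRepresentations.HOneUnramifiedProcyclic
import HarnessLib

/-!
# Kolyvagin's classes are locally Kummer wherever a subgroup of index prime to the level fixes
# the point (Gross 1991, Prop. 6.2 (1) without good reduction)

Topic `NumberTheory/EllipticCurves`; namespaces `Literature.NumberTheory.EllipticCurves`,
`….KolyvaginCocycle`, `….JZero`.  THEOREMS ONLY (D-0026: no definition, no named fact).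
Companion of `HeegnerPointsKolyvaginPrimaryUnramifiedProofs` (Gross's Prop. 6.2 (1) at the
unramified places of GOOD reduction: the local cocycle vanishes on inertia, and unramified
classes die by Milne, *ADT*, I.3.8) and of `RingClassFieldInertia` (its ring-class-field form).

**The mechanism.**  Kolyvagin's class `c(P) ∈ H¹(K, E[n])` of a point `P ∈ A ⊆ E(K̄)` maps, at a
`K`-field `F` (a completion `K_v`), to the class in `H¹(F, E)` of the cocycle
`σ ↦ -(σ - 1)P/n` (McCallum 1991, Cor. 4.2; Gross 1991, proof of Prop. 6.2:
*"The localization `d(n)_λ` is represented by the cocycle `σ ↦ -(σ-1)P_n/p`"*; the tree's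
`KolyvaginCocycle.map_cls_eq_pullback_negRootCocycle`).  If an OPEN subgroup `Φ ≤ Γ_F` FIXES `P`,
this cocycle VANISHES on `Φ`, so its class `η` restricts to `0 ∈ H¹(Φ, E)`, whence
`(Γ_F : Φ) · η = cor(res η) = 0` (Serre, *Galois Cohomology*, I §2.4 Prop. 9: `cor ∘ res = (G : H)`;
the tree's `cores_resSubgroup`); and `n · η = 0` because `n · (-(σ-1)P/n) = -(σ-1)P` is a
coboundary.  Hence **`η = 0` as soon as `gcd((Γ_F : Φ), n) = 1`**: `c(P)` satisfies the Selmer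
local condition at `F` — with NO hypothesis on the reduction of `E` at the place, and NO
hypothesis that inertia fixes `P`.

* §1 `KolyvaginCocycle.index_smul_eq_zero_of_resSubgroup_eq_zero` /
  `…index_smul_oneCocycleClass_eq_zero_of_vanishing` — `(G : Φ) · η = 0` for a class restricting
  to zero on (a cocycle vanishing on) an open subgroup `Φ` of finite index, ANY topological
  coefficients; `…eq_zero_of_resSubgroup_eq_zero_of_isCoprime` — `η = 0` if moreover `n · η = 0`,
  `gcd((G : Φ), n) = 1`.
* §2 `KolyvaginCocycle.cls_mem_resKer_of_fixing_of_isCoprime` — the abstract local statement along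
  a compatible pair `(θ : H → G, Ψ : M → M')` (twin of `cls_mem_resKer_of_vanishing`).
* §3 `kolyvaginClass_mem_selmerLocalKer_of_fixing_of_isCoprime` — for a Weierstrass curve over any
  field `K` and ANY `K`-field `F`: an open `Φ ≤ Γ_F` of index coprime to `n` fixing `P` through
  `resGal` puts `c(P)` in `selmerLocalKer W F n`; `…_of_index_stabilizer_isCoprime` — the same with
  `Φ` = the local stabilizer of `P` (hypothesis: *its index is prime to `n`*); the embedding
  variants `…OfEmb…`.
* §4 `JZero.kolyvaginClass_cubicTwist_mem_selmerLocalKer_of_fixing_of_isCoprime` — the cubic-twist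
  (CM-frame) form, twin of `JZero.kolyvaginClass_cubicTwist_mem_selmerLocalKer_of_inertia`
  (`RingClassFieldInertia`) with `(hgood, h𝔐, hI)` replaced by `(Φ, hΦ, hcop, hΦS)`.
* §5 `JZero.smul_chiComponent_eq_self` — the `χ`-component `P^χ = Σ_i ρ_{t_i}(t_i P)` of
  `KolyvaginChiComponent` / `CubicTwistKolyvaginClassesJZero` is fixed by every `φ ∈ Γ_k` fixing
  `P`, when `N` fixes `P` and `Γ_k/N` is abelian; whence the one-call form
  `JZero.kolyvaginClass_cubicTwist_chiComponent_mem_selmerLocalKer_of_isCoprime` (hypotheses: `Φ`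
  open of index prime to `n`, fixing `v` and `P` through `resGal`).

**Where it is used** (cell bsd-cm, crux `UpperOffV0HSYPlus`, leaf (L1) of VARIANT K at the
additive place `w ∣ 3` of `K = ℚ(ω)` for `B = E_p`, `p ≡ 7 (mod 9)`; memo two §67.2 (W2-d)):
there `H¹(K_w, B[2]) ≠ 0` and `B` has additive reduction, so neither the vanishing of the local
`H¹` nor Prop. 6.2 (1) applies; instead the decomposition group of the tower field at `w` is
`I_w × ⟨φ_w⟩` with `#I_w = 9` and the Frobenius part `φ_w` FIXES the CM points, so the preimage
`Φ` of `⟨φ_w⟩` is an open subgroup of `Γ_{K_w}` of index `9`, prime to `2^M`, fixing `P_n^χ` —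
exactly the hypothesis of §3/§4.  (The fixing itself is THEOREM C's identity transported up the
tower; it is an INPUT here, not proved.)  Nothing in this file is specific to that frame.

## References

* B. H. Gross, *Kolyvagin's work on modular elliptic curves*, in *`L`-functions and arithmetic
  (Durham, 1989)*, LMS Lecture Note Ser. 153, CUP (1991), 235–256: Prop. 6.2 and its proof
  (held `book:editornd-l-functions-arithmetic`, PDF pp. 221–223). [GrossLMS1991]
* W. G. McCallum, *Kolyvagin's work on Shafarevich–Tate groups*, same volume, 295–316: §4,
  Cor. 4.2, Lemma 4.3 (PDF pp. 281–282). [McCallumLMS1991]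
* J.-P. Serre, *Galois Cohomology* (1997), I §2.4, Prop. 9 (`cor ∘ res = (G : H)`).
  [SerreGaloisCohomology1997]
* J. Neukirch, A. Schmidt, K. Wingberg, *Cohomology of Number Fields*, 2nd ed. (2008), (1.5.7),
  (1.6.7). [NeukirchSchmidtWingberg2008]
-/

noncomputable section

open scoped Classical
open scoped AddSubgroup
open WeierstrassCurve NumberField IsDedekindDomain
open Literature.NumberTheory.GaloisRepresentations

universe u v

namespace Literature.NumberTheory.EllipticCurves

namespace KolyvaginCocycle

/-! ## §1 A class restricting to zero on an open subgroup of index prime to its order vanishes -/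

section Index

variable {R : Type u} [CommRing R] [TopologicalSpace R]
variable {G : Type v} [Group G] [TopologicalSpace G] [IsTopologicalGroup G]
variable (X : TopRep.{v} R G)

/-- **`(G : Φ) · η = 0` for a class killed by `res : H¹(G, X) → H¹(Φ, X)`**, `Φ` an open
subgroup of finite index, arbitrary topological coefficients: `(G : Φ) · η = cor(res η) = cor 0`
(Serre, *Galois Cohomology*, I §2.4 Prop. 9; the tree's `cores_resSubgroup`).
[cite: SerreGaloisCohomology1997, I §2.4 Prop. 9] [cite: NeukirchSchmidtWingberg2008, (1.5.7)] -/
theorem index_smul_eq_zero_of_resSubgroup_eq_zero (Φ : Subgroup G) (hΦ : IsOpen (Φ : Set G))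
    [Φ.FiniteIndex] (η : continuousCohomology 1 X) (hη : resSubgroup X Φ 1 η = 0) :
    Φ.index • η = 0 := by
  haveI : Fintype (G ⧸ Φ) := Fintype.ofFinite _
  have h := cores_resSubgroup X Φ hΦ η
  rw [hη, map_zero] at h
  rw [← Nat.cast_smul_eq_nsmul R Φ.index η]
  exact h.symm

/-- **`(G : Φ) · [φ] = 0` for a continuous cocycle VANISHING on an open subgroup `Φ` of finite
index** (its restriction to `Φ` is the zero cocycle). [cite: SerreGaloisCohomology1997, I §2.4
Prop. 9] [cite: NeukirchSchmidtWingberg2008, (1.6.7)] -/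
theorem index_smul_oneCocycleClass_eq_zero_of_vanishing (Φ : Subgroup G)
    (hΦ : IsOpen (Φ : Set G)) [Φ.FiniteIndex] (φ : contOneCocycles X)
    (hφ : ∀ σ ∈ Φ, φ.1 σ = 0) : Φ.index • oneCocycleClass X φ = 0 :=
  index_smul_eq_zero_of_resSubgroup_eq_zero X Φ hΦ _
    (resSubgroup_oneCocycleClass_eq_zero_of_vanishing X φ fun σ ↦ hφ σ σ.2)

omit [TopologicalSpace R] [TopologicalSpace G] [IsTopologicalGroup G] in
/-- Bezout: an element killed by a natural number `a` and an integer `n` with `gcd(a, n) = 1` is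
zero. [folklore] -/
private theorem eq_zero_of_nsmul_eq_zero_of_zsmul_eq_zero {Y : Type*} [AddCommGroup Y] (y : Y)
    {a : ℕ} {n : ℤ} (ha : a • y = 0) (hn : n • y = 0) (hcop : IsCoprime (a : ℤ) n) : y = 0 := by
  obtain ⟨s, t, hst⟩ := hcop
  calc y = (1 : ℤ) • y := (one_zsmul y).symm
    _ = (s * a + t * n) • y := by rw [hst]
    _ = 0 := by rw [add_zsmul, mul_zsmul, mul_zsmul, natCast_zsmul, ha, hn, zsmul_zero,
          zsmul_zero, add_zero]

/-- **A class killed by restriction to an open subgroup `Φ` and by an integer `n` prime to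
`(G : Φ)` is zero**: `(G : Φ) · η = 0` (`cor ∘ res`) and `n · η = 0`, `gcd = 1`.  (If `Φ` has
infinite index, `(G : Φ) = 0` by convention and the coprimality forces `n = ±1`.)
[cite: SerreGaloisCohomology1997, I §2.4 Prop. 9] -/
theorem eq_zero_of_resSubgroup_eq_zero_of_isCoprime (Φ : Subgroup G) (hΦ : IsOpen (Φ : Set G))
    (η : continuousCohomology 1 X) (hη : resSubgroup X Φ 1 η = 0) {n : ℤ} (hn : n • η = 0)
    (hcop : IsCoprime (Φ.index : ℤ) n) : η = 0 := by
  by_cases hidx : Φ.index = 0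
  · rw [hidx, Nat.cast_zero, isCoprime_zero_left] at hcop
    rcases Int.isUnit_iff.mp hcop with rfl | rfl
    · rwa [one_zsmul] at hn
    · rwa [neg_zsmul, one_zsmul, neg_eq_zero] at hn
  · haveI : Φ.FiniteIndex := ⟨hidx⟩
    exact eq_zero_of_nsmul_eq_zero_of_zsmul_eq_zero η
      (index_smul_eq_zero_of_resSubgroup_eq_zero X Φ hΦ η hη) hn hcop

/-- Cocycle form: **a continuous cocycle vanishing on an open subgroup `Φ`, whose class is killed by
an integer `n` prime to `(G : Φ)`, has trivial class.** [cite: SerreGaloisCohomology1997, I §2.4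
Prop. 9] [cite: NeukirchSchmidtWingberg2008, (1.6.7)] -/
theorem oneCocycleClass_eq_zero_of_vanishing_of_isCoprime (Φ : Subgroup G)
    (hΦ : IsOpen (Φ : Set G)) (φ : contOneCocycles X) (hφ : ∀ σ ∈ Φ, φ.1 σ = 0) {n : ℤ}
    (hn : n • oneCocycleClass X φ = 0) (hcop : IsCoprime (Φ.index : ℤ) n) :
    oneCocycleClass X φ = 0 :=
  eq_zero_of_resSubgroup_eq_zero_of_isCoprime X Φ hΦ _
    (resSubgroup_oneCocycleClass_eq_zero_of_vanishing X φ fun σ ↦ hφ σ σ.2) hn hcop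

end Index

/-! ## §2 The local condition from a fixing subgroup of index prime to `n` -/

section Local

variable {G : Type u} [Group G] [TopologicalSpace G] [IsTopologicalGroup G]
variable {M : Type u} [AddCommGroup M] [DistribMulAction G M] [TopologicalSpace M]
  [DiscreteTopology M]
variable {H : Type u} [Group H] [TopologicalSpace H] [IsTopologicalGroup H]
variable {M' : Type u} [AddCommGroup M'] [DistribMulAction H M'] [TopologicalSpace M']
  [DiscreteTopology M']
variable {A : AddSubgroup M} {n : ℤ}

omit [IsTopologicalGroup G] in
/-- **`n` kills the localization of `d(P)`**: along a compatible pair `(θ, Ψ)` the class of the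
cocycle `h ↦ -Ψ((θh - 1)P/n)` is `n`-torsion — `n · (-Ψ((θh-1)P/n)) = -(h·ΨP - ΨP)` is the
coboundary of `-ΨP` (Gross 1991, (4.5)–(4.6): `d(n)` lies in `H¹(K, E)_p`).
[cite: GrossLMS1991, §4 (4.5)–(4.6)] [cite: McCallumLMS1991, Cor. 4.2] -/
theorem zsmul_oneCocycleClass_pullback_negRootCocycle_eq_zero (θ : H →ₜ* G) (Ψ : M →+ M')
    (hΨ : ∀ (h : H) (m : M), Ψ (θ h • m) = h • Ψ m)
    (hA : IsAdmissible G A n) (hcont : ∀ m : M, Continuous fun g : G ↦ g • m)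
    {P : M} (hP : P ∈ invPoints G A n) :
    n • oneCocycleClass _ (contOneCocycles.pullback θ (resHomOfEquivariant θ Ψ hΨ)
        (negRootCocycle hA hcont hP)) = 0 := by
  rw [← Int.cast_smul_eq_zsmul ℤ n, ← oneCocycleClass_smul, oneCocycleClass_eq_zero_iff]
  refine ⟨-Ψ P, fun h ↦ ?_⟩
  rw [Submodule.coe_smul, ContinuousMap.smul_apply, contOneCocycles.pullback_apply,
    negRootCocycle_apply, Int.cast_id]
  change n • Ψ (-rootIn A n (θ h • P - P)) = h • (-Ψ P) - -Ψ P
  rw [map_neg, smul_neg, ← map_zsmul, (rootIn_smul_sub_spec hP (θ h)).2, map_sub, hΨ, smul_neg]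
  abel

/-- **Gross's Prop. 6.2 (1) without good reduction — fixing subgroup of index prime to `n` ⇒
local condition.**  Along a compatible pair `(θ : H → G, Ψ : M → M')` (printed:
`Γ_{K_v} → Γ_K`, `E(K̄) → E(K̄_v)`), let `Φ ≤ H` be an OPEN subgroup whose index is prime to `n`
and which fixes `P` through `θ`.  Then Kolyvagin's class `c(P; Q)` lies in the kernel of
`H¹(G, M[n]) → H¹(H, M')`: its image is the class of `h ↦ -Ψ((θh-1)P/n)` (McCallum Cor. 4.2),
a cocycle vanishing on `Φ`, so the class is killed by `(H : Φ)` (`cor ∘ res`) and by `n`, hence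
is `0`.  (Gross's printed case: `Φ ⊇` inertia and good reduction, where instead
`H¹(K_v^{un}/K_v, E) = 0`; here the reduction type is arbitrary.)
[cite: GrossLMS1991, Prop. 6.2 (1)] [cite: McCallumLMS1991, Cor. 4.2, Lemma 4.3]
[cite: SerreGaloisCohomology1997, I §2.4 Prop. 9] -/
theorem cls_mem_resKer_of_fixing_of_isCoprime (θ : H →ₜ* G) (Ψ : M →+ M')
    (hΨ : ∀ (h : H) (m : M), Ψ (θ h • m) = h • Ψ m)
    (hA : IsAdmissible G A n) (hcont : ∀ m : M, Continuous fun g : G ↦ g • m)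
    {P : M} (hP : P ∈ invPoints G A n) {Q : M} (hQ : n • Q = P)
    (hc : ∀ (h : H) (x : M[n]),
      (Ψ.comp (M[n]).subtype) (θ h • x) = h • (Ψ.comp (M[n]).subtype) x)
    (Φ : Subgroup H) (hΦ : IsOpen (Φ : Set H)) (hcop : IsCoprime (Φ.index : ℤ) n)
    (hfix : ∀ σ ∈ Φ, θ σ • P = P) :
    cls hA hcont hP hQ ∈ resKer θ (Ψ.comp (M[n]).subtype) hc := by
  rw [mem_resKer_iff, map_cls_eq_pullback_negRootCocycle θ Ψ hΨ hA hcont hP hQ hc]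
  refine oneCocycleClass_eq_zero_of_vanishing_of_isCoprime _ Φ hΦ _ (fun σ hσ ↦ ?_)
    (zsmul_oneCocycleClass_pullback_negRootCocycle_eq_zero θ Ψ hΨ hA hcont hP) hcop
  rw [contOneCocycles.pullback_apply, negRootCocycle_apply, hfix σ hσ, sub_self,
    rootIn_zero hA.eq_zero_of_zsmul, neg_zero]
  exact map_zero _

end Local

end KolyvaginCocycle

/-! ## §3 For a Weierstrass curve: the Selmer local condition at any `K`-field -/

section Curve

open KolyvaginCocycle

variable {K : Type u} [Field K] (W : WeierstrassCurve K) {n : ℤ}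
variable {hdiv : ∀ P : geomPoints W, ∃ Q : geomPoints W, n • Q = P}
variable {A : AddSubgroup (geomPoints W)}
variable {F : Type u} [Field F] [Algebra K F]

/-- **Kolyvagin's class is Selmer at `F` if an open subgroup of `Γ_F` of index prime to `n`
fixes the point** (embedding form).  For a Weierstrass curve `E/K`, a `K`-field `F` with a
`K`-embedding `ι : K̄ → F̄`, Kolyvagin's class `c(P) ∈ H¹(K, E[n])` (`P ∈ A ⊆ E(K̄)` admissible)
and an OPEN subgroup `Φ ≤ Γ_F` with `gcd((Γ_F : Φ), n) = 1` fixing `P` through `resGalOfEmb ι`: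
`c(P) ∈ selmerLocalKerOfEmb W F ι n`, i.e. its image in `H¹(F, E(F̄))` vanishes.  No hypothesis
on the reduction of `E`.  (Printed cases: `Φ = Γ_F` — McCallum Lemma 4.3 at a split place, the
tree's `kolyvaginClass_mem_selmerLocalKerOfEmb_of_forall_smul_eq`; `Φ ⊇` inertia at good
reduction — Gross Prop. 6.2 (1).) [cite: GrossLMS1991, Prop. 6.2 (1)]
[cite: McCallumLMS1991, Lemma 4.3] [cite: SerreGaloisCohomology1997, I §2.4 Prop. 9] -/
theorem kolyvaginClass_mem_selmerLocalKerOfEmb_of_fixing_of_isCoprime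
    (hA : IsAdmissible (Field.absoluteGaloisGroup K) A n) {P : geomPoints W}
    (hP : P ∈ invPoints (Field.absoluteGaloisGroup K) A n)
    (ι : AlgebraicClosure K →ₐ[K] AlgebraicClosure F)
    (Φ : Subgroup (Field.absoluteGaloisGroup F)) (hΦ : IsOpen (Φ : Set (Field.absoluteGaloisGroup F)))
    (hcop : IsCoprime (Φ.index : ℤ) n)
    (hfix : ∀ σ ∈ Φ, resGalOfEmb ι σ • P = P) :
    kolyvaginClass W n hdiv hA P hP ∈ selmerLocalKerOfEmb W F ι n :=
  cls_mem_resKer_of_fixing_of_isCoprime (resGalOfEmb ι) (pointsMapOfEmb W ι)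
    (pointsMapOfEmb_smul W ι) hA _ hP _ _ Φ hΦ hcop hfix

/-- **Kolyvagin's class is Selmer at `F` if an open subgroup of `Γ_F` of index prime to `n`
fixes the point** (chosen embedding `closureEmb F`; `selmerLocalKer`).  For `F = K_v` a
completion this is the Selmer local condition at `v`, for ANY reduction type of `E` at `v`.
[cite: GrossLMS1991, Prop. 6.2 (1)] [cite: McCallumLMS1991, Lemma 4.3]
[cite: SerreGaloisCohomology1997, I §2.4 Prop. 9] -/
theorem kolyvaginClass_mem_selmerLocalKer_of_fixing_of_isCoprime
    (hA : IsAdmissible (Field.absoluteGaloisGroup K) A n) {P : geomPoints W}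
    (hP : P ∈ invPoints (Field.absoluteGaloisGroup K) A n)
    (Φ : Subgroup (Field.absoluteGaloisGroup F)) (hΦ : IsOpen (Φ : Set (Field.absoluteGaloisGroup F)))
    (hcop : IsCoprime (Φ.index : ℤ) n)
    (hfix : ∀ σ ∈ Φ, resGal (K := K) F σ • P = P) :
    kolyvaginClass W n hdiv hA P hP ∈ selmerLocalKer W F n :=
  cls_mem_resKer_of_fixing_of_isCoprime (resGal (K := K) F) (pointsMap W F)
    (pointsMap_smul W F) hA _ hP _ _ Φ hΦ hcop hfix

/-- The stabilizer of a geometric point is open in `Γ_K` (`E(K̄)` is a discrete `Γ_K`-module).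
[folklore] -/
private theorem isOpen_stabilizer_geomPoints (P : geomPoints W) :
    IsOpen (MulAction.stabilizer (Field.absoluteGaloisGroup K) P : Set (Field.absoluteGaloisGroup K)) := by
  have h : (MulAction.stabilizer (Field.absoluteGaloisGroup K) P : Set (Field.absoluteGaloisGroup K)) =
      (fun σ : Field.absoluteGaloisGroup K ↦ σ • P) ⁻¹' {P} := by
    ext σ; simp [MulAction.mem_stabilizer_iff]
  rw [h]
  exact (isOpen_discrete {P}).preimage (continuous_smul_geomPoints W P)

/-- **Stabilizer form**: if the LOCAL STABILIZER of `P` — the preimage in `Γ_F` of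
`Stab_{Γ_K}(P)` under `resGal` (printed: `Gal(F̄/F·K(P))`) — has index prime to `n`, then
Kolyvagin's class `c(P)` satisfies the Selmer local condition at `F`.  (At a place where the
decomposition group of `K(P)/K` is `I × ⟨φ⟩` with `φ` fixing `P`, that index is `#I`.)
[cite: GrossLMS1991, Prop. 6.2 (1)] [cite: McCallumLMS1991, Lemma 4.3]
[cite: SerreGaloisCohomology1997, I §2.4 Prop. 9] -/
theorem kolyvaginClass_mem_selmerLocalKer_of_index_stabilizer_isCoprime
    (hA : IsAdmissible (Field.absoluteGaloisGroup K) A n) {P : geomPoints W}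
    (hP : P ∈ invPoints (Field.absoluteGaloisGroup K) A n)
    (hcop : IsCoprime
      (((MulAction.stabilizer (Field.absoluteGaloisGroup K) P).comap
        (resGal (K := K) F).toMonoidHom).index : ℤ) n) :
    kolyvaginClass W n hdiv hA P hP ∈ selmerLocalKer W F n :=
  kolyvaginClass_mem_selmerLocalKer_of_fixing_of_isCoprime W hA hP _
    ((isOpen_stabilizer_geomPoints W P).preimage (resGal (K := K) F).continuous) hcop
    fun _ hσ ↦ hσ

/-- **Set form** (the shape of the tree's `…_of_inertia` lemmas): if an open subgroup `Φ ≤ Γ_F`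
of index prime to `n` restricts into a SET `S ⊆ Γ_K` fixing `P`, then `c(P)` is Selmer at `F`.
[cite: GrossLMS1991, Prop. 6.2 (1)] [cite: McCallumLMS1991, Lemma 4.3]
[cite: SerreGaloisCohomology1997, I §2.4 Prop. 9] -/
theorem kolyvaginClass_mem_selmerLocalKer_of_resGal_mem_of_isCoprime
    (hA : IsAdmissible (Field.absoluteGaloisGroup K) A n) {P : geomPoints W}
    (hP : P ∈ invPoints (Field.absoluteGaloisGroup K) A n)
    {S : Set (Field.absoluteGaloisGroup K)} (hS : ∀ g ∈ S, g • P = P)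
    (Φ : Subgroup (Field.absoluteGaloisGroup F)) (hΦ : IsOpen (Φ : Set (Field.absoluteGaloisGroup F)))
    (hcop : IsCoprime (Φ.index : ℤ) n)
    (hΦS : ∀ σ ∈ Φ, resGal (K := K) F σ ∈ S) :
    kolyvaginClass W n hdiv hA P hP ∈ selmerLocalKer W F n :=
  kolyvaginClass_mem_selmerLocalKer_of_fixing_of_isCoprime W hA hP Φ hΦ hcop
    fun σ hσ ↦ hS _ (hΦS σ hσ)

end Curve

/-! ## §4 The cubic-twist (CM-frame) form -/

section CubicTwist

open KolyvaginCocycle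

variable {K : Type u} [Field K] {W W' : WeierstrassCurve K}
variable {F : Type u} [Field F] [Algebra K F]

/-- **The CM-frame classes are Selmer wherever an index-prime-to-`n` open subgroup of the local
Galois group fixes `∛c` and the point.**  Let `ψ : E(K̄) ≃ E'(K̄)` be the cubic-twist transport
`(x, y) ↦ (v²x, v³y)` (`v³ = c`), `S ⊆ Γ_K` a set fixing `v` and the point `Q ∈ E(K̄)`, and
`c(ψ Q)` Kolyvagin's class of `ψ Q` (level `n`, admissible `A`).  If at the `K`-field `F`
(printed: `F = K_w`, `w ∣ 3`, `p ≡ 7 (9)`) an OPEN subgroup `Φ ≤ Γ_F` of index prime to `n`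
restricts into `S`, then `c(ψ Q) ∈ selmerLocalKer W' F n`: `Φ` fixes `ψ Q`
(`JZero.forall_smul_cubicTwist_eq_iff`), and §3 applies.  Twin of
`JZero.kolyvaginClass_cubicTwist_mem_selmerLocalKer_of_inertia` with `(hgood, h𝔐, hI)` replaced
by `(Φ, hΦ, hcop, hΦS)`; no reduction hypothesis.  [cite: GrossLMS1991, Prop. 6.2 (1)]
[cite: McCallumLMS1991, Lemma 4.3] [cite: SerreGaloisCohomology1997, I §2.4 Prop. 9]
[cite: HuShuYin2019, §2 p. 8] -/
theorem JZero.kolyvaginClass_cubicTwist_mem_selmerLocalKer_of_fixing_of_isCoprime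
    {v : AlgebraicClosure K} {ψ : geomPoints W ≃+ geomPoints W'}
    (hψ : ∀ {x y : AlgebraicClosure K}
        (h : (W.baseChange (AlgebraicClosure K)).toAffine.Nonsingular x y),
        ∃ h', ψ (Affine.Point.some x y h) = Affine.Point.some (v ^ 2 * x) (v ^ 3 * y) h')
    {S : Set (Field.absoluteGaloisGroup K)}
    (hSv : ∀ h ∈ S, (show AlgebraicClosure K ≃ₐ[K] AlgebraicClosure K from h) v = v)
    {A : AddSubgroup (geomPoints W')} {n : ℤ}
    {hdiv : ∀ P : geomPoints W', ∃ R : geomPoints W', n • R = P}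
    (hA : IsAdmissible (Field.absoluteGaloisGroup K) A n)
    {Q : geomPoints W} (hQS : ∀ h ∈ S, h • Q = Q)
    (hQ' : ψ Q ∈ invPoints (Field.absoluteGaloisGroup K) A n)
    (Φ : Subgroup (Field.absoluteGaloisGroup F)) (hΦ : IsOpen (Φ : Set (Field.absoluteGaloisGroup F)))
    (hcop : IsCoprime (Φ.index : ℤ) n)
    (hΦS : ∀ σ ∈ Φ, resGal (K := K) F σ ∈ S) :
    kolyvaginClass W' n hdiv hA (ψ Q) hQ' ∈ selmerLocalKer W' F n :=
  kolyvaginClass_mem_selmerLocalKer_of_resGal_mem_of_isCoprime W' hA hQ'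
    ((JZero.forall_smul_cubicTwist_eq_iff hψ hSv Q).mpr hQS) Φ hΦ hcop hΦS

end CubicTwist

/-! ## §5 The `χ`-component is fixed by whatever fixes the point, modulo an abelian quotient -/

section ChiFixed

variable {Γ : Type*} [Group Γ] {M : Type*} [AddCommGroup M] [DistribMulAction Γ M]

/-- **Conjugates of a fixed point are fixed, modulo an abelian quotient.**  If a subgroup `N ≤ Γ`
fixes `P`, all commutators of `Γ` lie in `N` (printed: `N = Gal(k̄/H)` for an ABELIAN extension
`H/k` — a ring class field) and `φ` fixes `P`, then `φ` fixes every conjugate `t • P`: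
`(φ t) • P = t • P` (`φ t = t · [t⁻¹, φ] · φ`). [folklore] -/
private theorem mul_smul_eq_smul_of_commutator_mem (N : Subgroup Γ)
    (hcomm : ∀ g h : Γ, g * h * g⁻¹ * h⁻¹ ∈ N) {P : M} (hPN : ∀ h ∈ N, h • P = P) {φ : Γ}
    (hφ : φ • P = P) (t : Γ) : (φ * t) • P = t • P := by
  have e : φ * t = t * (t⁻¹ * φ * t⁻¹⁻¹ * φ⁻¹) * φ := by group
  rw [e, mul_smul, mul_smul, hφ, hPN _ (hcomm t⁻¹ φ)]

variable {k : Type u} [Field k] {W W' : WeierstrassCurve k}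
variable {F : Type u} [Field F] [Algebra k F]

/-- **The `χ`-component `P^χ = Σ_i ρ_{t_i}(t_i P)` is fixed by every `φ ∈ Γ_k` fixing `P`**, when
`N ≤ Γ_k` fixes `P` and `Γ_k/N` is abelian (`μ₃ ⊂ k`, so the CM automorphisms `ρ_g` commute with
`Γ_k`: `φ ρ_{t_i}(t_i P) = ρ_{t_i}(φ t_i P) = ρ_{t_i}(t_i P)`).  Printed: `φ = φ_w`, the Frobenius
part of the decomposition group at `w ∣ 3`, fixing the CM points of the tower (memo two §67.2
(W2-b)); `N = Gal(k̄/K[9pn])`. [cite: HuShuYin2019, §1 p. 4] [cite: GrossLMS1991, §12 (y_χ)] -/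
theorem JZero.smul_chiComponent_eq_self {ω : k} (hω : ω ^ 2 + ω + 1 = 0)
    {v : AlgebraicClosure k} (hv : v ≠ 0)
    (hv3 : ∀ g : Field.absoluteGaloisGroup k,
      ((show AlgebraicClosure k ≃ₐ[k] AlgebraicClosure k from g) v) ^ 3 = v ^ 3)
    {ρ : Field.absoluteGaloisGroup k → geomPoints W ≃+ geomPoints W}
    (hρ : ∀ (g : Field.absoluteGaloisGroup k) {x y : AlgebraicClosure k}
        (h : (W.baseChange (AlgebraicClosure k)).toAffine.Nonsingular x y),
        ∃ h', ρ g (Affine.Point.some x y h) =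
          Affine.Point.some (((show AlgebraicClosure k ≃ₐ[k] AlgebraicClosure k from g) v / v) ^ 2 * x)
            y h')
    (N : Subgroup (Field.absoluteGaloisGroup k))
    (hcomm : ∀ g h : Field.absoluteGaloisGroup k, g * h * g⁻¹ * h⁻¹ ∈ N)
    {ι : Type*} [Fintype ι] (t : ι → Field.absoluteGaloisGroup k) {P : geomPoints W}
    (hPN : ∀ h ∈ N, h • P = P) {φ : Field.absoluteGaloisGroup k} (hφ : φ • P = P) :
    φ • (∑ i, ρ (t i) (t i • P)) = ∑ i, ρ (t i) (t i • P) := by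
  rw [Finset.smul_sum]
  refine Finset.sum_congr rfl fun i _ ↦ ?_
  rw [smul_rho_of_omega hω hv hv3 hρ (t i) φ, ← mul_smul,
    mul_smul_eq_smul_of_commutator_mem N hcomm hPN hφ]

open KolyvaginCocycle in
/-- **(L1) at an additive place for the CM-frame classes, one call.**  In the CM frame of
`CubicTwistTransportJZero` / `CubicTwistKolyvaginClassesJZero` (`μ₃ ⊂ k`; transport `ψ` with cube
root `v` of `c`; CM automorphisms `ρ_g`; `N ≤ Γ_k` with abelian quotient fixing the derived point
`P`; representatives `t`; Kolyvagin's class of `ψ(P^χ)`, `P^χ = Σ_i ρ_{t_i}(t_i P)`): if at the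
`k`-field `F` an OPEN subgroup `Φ ≤ Γ_F` of index prime to `n` fixes `v` and `P` through
`resGal`, then the class is Selmer at `F`.  (§5 + §4: `Φ` fixes `P^χ`, then
`JZero.kolyvaginClass_cubicTwist_mem_selmerLocalKer_of_fixing_of_isCoprime` with
`S = {g | g v = v ∧ g P = P}`.)  Printed instance: `F = K_w`, `w ∣ 3`, `p ≡ 7 (9)`, `Φ` = preimage
of `⟨φ_w⟩`, index `#I_w = 9`, `n = 2^M` (memo two §67.2 (W2-d)); the fixing `φ_w P_n = P_n` and the
index are INPUTS. [cite: GrossLMS1991, Prop. 6.2 (1), §12] [cite: McCallumLMS1991, Lemma 4.3]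
[cite: SerreGaloisCohomology1997, I §2.4 Prop. 9] [cite: HuShuYin2019, §1 p. 4, §2 p. 8] -/
theorem JZero.kolyvaginClass_cubicTwist_chiComponent_mem_selmerLocalKer_of_isCoprime {ω : k}
    (hω : ω ^ 2 + ω + 1 = 0) {v : AlgebraicClosure k} (hv : v ≠ 0)
    (hv3 : ∀ g : Field.absoluteGaloisGroup k,
      ((show AlgebraicClosure k ≃ₐ[k] AlgebraicClosure k from g) v) ^ 3 = v ^ 3)
    {ρ : Field.absoluteGaloisGroup k → geomPoints W ≃+ geomPoints W}
    (hρ : ∀ (g : Field.absoluteGaloisGroup k) {x y : AlgebraicClosure k}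
        (h : (W.baseChange (AlgebraicClosure k)).toAffine.Nonsingular x y),
        ∃ h', ρ g (Affine.Point.some x y h) =
          Affine.Point.some (((show AlgebraicClosure k ≃ₐ[k] AlgebraicClosure k from g) v / v) ^ 2 * x)
            y h')
    {ψ : geomPoints W ≃+ geomPoints W'}
    (hψ : ∀ {x y : AlgebraicClosure k}
        (h : (W.baseChange (AlgebraicClosure k)).toAffine.Nonsingular x y),
        ∃ h', ψ (Affine.Point.some x y h) = Affine.Point.some (v ^ 2 * x) (v ^ 3 * y) h')
    (N : Subgroup (Field.absoluteGaloisGroup k))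
    (hcomm : ∀ g h : Field.absoluteGaloisGroup k, g * h * g⁻¹ * h⁻¹ ∈ N)
    {ι : Type*} [Fintype ι] (t : ι → Field.absoluteGaloisGroup k)
    {A : AddSubgroup (geomPoints W')} {n : ℤ}
    {hdiv : ∀ P : geomPoints W', ∃ R : geomPoints W', n • R = P}
    (hA : IsAdmissible (Field.absoluteGaloisGroup k) A n)
    {P : geomPoints W} (hPN : ∀ h ∈ N, h • P = P)
    (hQ' : ψ (∑ i, ρ (t i) (t i • P)) ∈ invPoints (Field.absoluteGaloisGroup k) A n)
    (Φ : Subgroup (Field.absoluteGaloisGroup F)) (hΦ : IsOpen (Φ : Set (Field.absoluteGaloisGroup F)))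
    (hcop : IsCoprime (Φ.index : ℤ) n)
    (hΦv : ∀ σ ∈ Φ, (show AlgebraicClosure k ≃ₐ[k] AlgebraicClosure k from resGal (K := k) F σ) v = v)
    (hΦP : ∀ σ ∈ Φ, resGal (K := k) F σ • P = P) :
    kolyvaginClass W' n hdiv hA (ψ (∑ i, ρ (t i) (t i • P))) hQ' ∈ selmerLocalKer W' F n :=
  JZero.kolyvaginClass_cubicTwist_mem_selmerLocalKer_of_fixing_of_isCoprime hψ
    (S := {g | (show AlgebraicClosure k ≃ₐ[k] AlgebraicClosure k from g) v = v ∧ g • P = P})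
    (fun _ hh ↦ hh.1) hA
    (fun _ hh ↦ JZero.smul_chiComponent_eq_self hω hv hv3 hρ N hcomm t hPN hh.2) hQ' Φ hΦ hcop
    fun σ hσ ↦ ⟨hΦv σ hσ, hΦP σ hσ⟩

end ChiFixed

end Literature.NumberTheory.EllipticCurves

end
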